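import Summits.QuantumFields.BalabanUV.Beta.FP.SymmetryKSlot
import Summits.QuantumFields.BalabanUV.Beta.GAN24.KSlotAssembly

/-!
# `BalabanUV.Beta.FP.SymmetryKHolds` — road «FP» for binder row D1, leaf N3(ii)-K at `m = 1`, UNCONDITIONAL IN DIMENSION FOUR (`d = 3`, every `Lc ≥ 2`):
# the perfect ONE-STEP resolvent `KPerf Lc (sfStep Lc) (smStep 3 Lc) 1` (adopted units) DECAYS EXPONENTIALLY, is BLOCK-COVARIANT and is
# REFLECTION-INVARIANT for every axis — `FP.SymmetryKSlot.kernelSide_KPerf_one_of_convCKWall` fed by gan24's END node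
# `GAN24.KSlotAssembly.convCKWall_holds : 2 ≤ Lc → ConvCKWall 3 Lc` (the K-slot of row G-an2-4, a tree theorem: p204341, gan24 carver-g4), BY NAME

HONEST FRAMING (cell contract, verbatim): «discharging `BetaPertH` makes Bałaban's UV stability UNCONDITIONAL — a real constructive-QFT
result; it is NOT the continuum limit and NOT the Clay problem.»  HEADLINE DISCIPLINE (as in `KSlotAssembly`, ruling C2/c4): the headline of this file is
«the three KERNEL-SIDE binders (`hKd`, `hKs`, `hKr`) of every K-generic reflection END hold at the perfect one-step resolvent with NO hypothesis beyond
`2 ≤ Lc`» — NOT «N3 closed» (the JET-side covariances (St♭)(Wt)(Sr)(Wr) of the perfect stencils/tables and the Ward side N3(iii) remain), NOT «G-an2-4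
closed» (S/W slots, window, (D1) remain hypotheses of the wall), NOT BetaPertH, NOT continuum, NOT Clay.  Claim table
`HOME/b2b-balaban-beta-d1-p3/LEAVES-FP.md` row N3(ii)–(iv), sub-row N3(ii)-K (unit `b2b-balaban-beta-d1-formalise-leaf-06`).
ABSOLUTE RULE (cell, verbatim): «No internally-minted statement may enter as a cited fact. Every hypothesis is either kernel-proved in this
package or a verbatim quotation of a PUBLISHED theorem with page reference.»  Nothing is cited; no `def … : Prop`; every input is a tree THEOREM
imported BY NAME (`convCKWall_holds`, `kernelSide_KPerf_one_of_convCKWall`, `ResolventReflection.axisReflectionCovariant_flipK_hessKer`).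

CONTENT (all [our object]; `d = 3`, `2 ≤ Lc`, adopted units `(sfStep Lc, smStep 3 Lc) = (Lc^j, Lc^{4j})`).
* `exists_tendsto_KStepUnit` / `tendsto_KStepUnit_KPerf_one` — every entry of the unit-normalised step resolvents `KStepUnit Lc j` converges, and converges
  to the corresponding entry of `KPerf Lc (sfStep Lc) (smStep 3 Lc) 1` (X1-K at `m = 1`, from `convCKWall_holds`);
* **`kernelSide_KPerf_one_holds`** `(hLc : 2 ≤ Lc)` — the `(hKd, hKs, hKr)` triple at `K := KPerf Lc (sfStep Lc) (smStep 3 Lc) 1`, `N := Lc`;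
  **`decays_KPerf_one_holds`**, **`refK_KPerf_one_holds`** (the two conjuncts that needed X1-K; block covariance was already hypothesis-free);
* **`axisReflectionCovariant_flipK_hessKer_KPerf_one_holds`** — for ANY jet datum `J : JetData 3 Lc` with the four covariances (St♭)(Wt)(Sr)(Wr),
  `AxisReflectionCovariant (flipK (hessKer (KPerf …1) (vertexOfK (KPerf …1) Lc J.S) J.W))`: an5's END with ALL THREE kernel-side inputs now THEOREMS.
-/

namespace Summit.QuantumFields.BalabanUV.Beta.FP.SymmetryKHolds

open Filter Topology
open Literature.MathematicalPhysics.QuantumFieldTheory.Balaban1983to89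
open Literature.MathematicalPhysics.QuantumFieldTheory.Balaban1983to89.Beta
open ExpKernelCalculus (MKer Decays shiftK hessKer)
open PolarizationSign (reflSign AxisReflectionCovariant)
open KernelReflection (refK)
open ResolventReflection (Φ bref axisReflectionCovariant_flipK_hessKer)
open OneStepResolventKernel (Fib JetData)
open OneStepKernelFamily (KInvStep vertexOfK flipK)
open HessKerDressedLimit (limMKerOf)
open Summit.QuantumFields.BalabanUV.Beta.HessKerDressedUnits (unitK)
open Summit.QuantumFields.BalabanUV.Beta.GAN24.CombesThomas (KStepUnit ConvCKWall sfStep smStep)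
open Summit.QuantumFields.BalabanUV.Beta.GAN24.KSlotAssembly (convCKWall_holds)
open Summit.QuantumFields.BalabanUV.Beta.FP.PerfectObjects (KTot)
open Summit.QuantumFields.BalabanUV.Beta.FP.PerfectObjectsT (KPerf KPerf_one)
open Summit.QuantumFields.BalabanUV.Beta.FP.SymmetryK (tendsto_limMKerOf_of_exists shiftK_KPerf)
open Summit.QuantumFields.BalabanUV.Beta.FP.SymmetryKSlot (exists_tendsto_of_cauchyDecayK shiftK_KPerf_one kernelSide_KPerf_one_of_convCKWall)

noncomputable section

variable {Lc : ℕ} [NeZero Lc]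

/-- [our object] **X1-K AT `m = 1`, UNCONDITIONAL (`d = 3`, `2 ≤ Lc`)**: every entry of the unit-normalised step resolvents `KStepUnit Lc j` converges as
`j → ∞` (`convCKWall_holds` ⊢ `CauchyDecayK` ⊢ `SymmetryKSlot.exists_tendsto_of_cauchyDecayK`). -/
theorem exists_tendsto_KStepUnit (hLc : 2 ≤ Lc) (x y : Fin (3 + 1) → ℤ) (a b : Fib 3) :
    ∃ L : ℝ, Tendsto (fun j => KStepUnit (d := 3) Lc j x y a b) atTop (𝓝 L) := by
  obtain ⟨C, δ, cK, θ, _hδ, _hθ0, hθ1, _hK, hKall⟩ := convCKWall_holds hLc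
  exact exists_tendsto_of_cauchyDecayK (d := 3) Lc (sfStep Lc) (smStep 3 Lc) hKall hθ1 x y a b

/-- [our object] … and the limit IS the corresponding entry of the perfect one-step resolvent in the adopted units. -/
theorem tendsto_KStepUnit_KPerf_one (hLc : 2 ≤ Lc) (x y : Fin (3 + 1) → ℤ) (a b : Fib 3) :
    Tendsto (fun j => KStepUnit (d := 3) Lc j x y a b) atTop (𝓝 (KPerf (d := 3) Lc (sfStep Lc) (smStep 3 Lc) 1 x y a b)) := by
  rw [KPerf_one]
  exact tendsto_limMKerOf_of_exists (K := fun j => KStepUnit (d := 3) Lc j) (exists_tendsto_KStepUnit hLc) x y a b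

/-- **THE THREE KERNEL-SIDE BINDERS OF EVERY K-GENERIC REFLECTION END AT THE PERFECT ONE-STEP RESOLVENT — UNCONDITIONAL** (`d = 3`, `2 ≤ Lc`,
adopted units; `K := KPerf Lc (sfStep Lc) (smStep 3 Lc) 1`, `N := Lc`): `hKd` (∃ exponential decay), `hKs` (block covariance under `Lc`-translations),
`hKr` (reflection invariance `refK (Φ Lc α) K = K`, every axis `α`).  `SymmetryKSlot.kernelSide_KPerf_one_of_convCKWall` ∘ `KSlotAssembly.convCKWall_holds`. [our object] -/
theorem kernelSide_KPerf_one_holds (hLc : 2 ≤ Lc) :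
    (∃ δ₀ C₀ : ℝ, 0 < δ₀ ∧ 0 ≤ C₀ ∧ Decays (KPerf (d := 3) Lc (sfStep Lc) (smStep 3 Lc) 1) C₀ δ₀) ∧
    (∀ t : Fin (3 + 1) → ℤ, shiftK (-((Lc : ℤ) • t)) (KPerf (d := 3) Lc (sfStep Lc) (smStep 3 Lc) 1) = KPerf Lc (sfStep Lc) (smStep 3 Lc) 1) ∧
    (∀ α : Fin (3 + 1), refK (Φ (d := 3) Lc α) (KPerf (d := 3) Lc (sfStep Lc) (smStep 3 Lc) 1) = KPerf Lc (sfStep Lc) (smStep 3 Lc) 1) :=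
  kernelSide_KPerf_one_of_convCKWall (d := 3) Lc (convCKWall_holds hLc)

/-- **THE PERFECT ONE-STEP RESOLVENT DECAYS EXPONENTIALLY — UNCONDITIONAL** (`d = 3`, `2 ≤ Lc`). [our object] -/
theorem decays_KPerf_one_holds (hLc : 2 ≤ Lc) :
    ∃ δ₀ C₀ : ℝ, 0 < δ₀ ∧ 0 ≤ C₀ ∧ Decays (KPerf (d := 3) Lc (sfStep Lc) (smStep 3 Lc) 1) C₀ δ₀ :=
  (kernelSide_KPerf_one_holds hLc).1

/-- **THE PERFECT ONE-STEP RESOLVENT IS REFLECTION-INVARIANT FOR EVERY AXIS — UNCONDITIONAL** (`d = 3`, `2 ≤ Lc`). [our object] -/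
theorem refK_KPerf_one_holds (hLc : 2 ≤ Lc) (α : Fin (3 + 1)) :
    refK (Φ (d := 3) Lc α) (KPerf (d := 3) Lc (sfStep Lc) (smStep 3 Lc) 1) = KPerf Lc (sfStep Lc) (smStep 3 Lc) 1 :=
  (kernelSide_KPerf_one_holds hLc).2.2 α

/-- **THE TYPED REFLECTION LAW (5.7)–(5.8) OF THE UNDRESSED PERFECT ONE-STEP KERNEL, KERNEL SIDE UNCONDITIONAL** (`d = 3`, `2 ≤ Lc`): for ANY jet
datum `J` on blocking `Lc` whose stencil family is block-translation (St♭) and reflection (Sr) covariant and whose second-order family is block-translation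
(Wt) and reflection (Wr) covariant, `AxisReflectionCovariant (flipK (hessKer (KPerf …1) (vertexOfK (KPerf …1) Lc J.S) J.W))` — an5's
`axisReflectionCovariant_flipK_hessKer` with its three kernel-side inputs supplied by `kernelSide_KPerf_one_holds`.  The four jet covariances stay
HYPOTHESES (N3(ii)-S/W). [our object] -/
theorem axisReflectionCovariant_flipK_hessKer_KPerf_one_holds (hLc : 2 ≤ Lc) (J : JetData 3 Lc)
    (hSt : ∀ (κ' : Fin (3 + 1)) (u t : Fin (3 + 1) → ℤ), J.S κ' (u + (Lc : ℤ) • t) = shiftK (-((Lc : ℤ) • t)) (J.S κ' u))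
    (hWt : ∀ (μ : Fin (3 + 1)) (y : Fin (3 + 1) → ℤ) (ν : Fin (3 + 1)) (y' t : Fin (3 + 1) → ℤ),
      J.W μ (y + t) ν (y' + t) = shiftK (-((Lc : ℤ) • t)) (J.W μ y ν y'))
    (hSr : ∀ (α κ' : Fin (3 + 1)) (u : Fin (3 + 1) → ℤ), J.S κ' (bref α κ' u) = reflSign α κ' • refK (Φ (d := 3) Lc α) (J.S κ' u))
    (hWr : ∀ (α μ : Fin (3 + 1)) (y : Fin (3 + 1) → ℤ) (ν : Fin (3 + 1)) (y' : Fin (3 + 1) → ℤ),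
      J.W μ (bref α μ y) ν (bref α ν y') = (reflSign α μ * reflSign α ν) • refK (Φ (d := 3) Lc α) (J.W μ y ν y')) :
    AxisReflectionCovariant (flipK (hessKer (KPerf (d := 3) Lc (sfStep Lc) (smStep 3 Lc) 1)
      (vertexOfK (KPerf (d := 3) Lc (sfStep Lc) (smStep 3 Lc) 1) Lc J.S) J.W)) := by
  obtain ⟨hKd, hKs, hKr⟩ := kernelSide_KPerf_one_holds hLc
  exact axisReflectionCovariant_flipK_hessKer hKd hKs hKr J hSt hWt hSr hWr

end

end Summit.QuantumFields.BalabanUV.Beta.FP.SymmetryKHolds
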